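import Summits.QuantumFields.YangMills.Theorems.BalabanUVNodesN06CutL2LettersAtPinsPhysRParB

/-!
# BalabanUVNodes ∕ N06 ([B9], `Dag.B9_main`) — R1 J-TWIN (KD‴ LEGS): THE CUT L² LETTERS `vDRDG ∕ vGDRD` AT PHYSICAL PINS (budgeted edition B), ALONG A SUB-FAMILY `f : J → MemberY …` — the J-twin of
# ✓`…N06CutL2LettersAtPinsPhysRParB.vDRDG_vGDRD_of_pinsR_parB`

Track A of `YM-PLAN.md` (cell `pub-ymgap`, HUMAN RULING D-0062), node **N06** = [Balaban1985BackgroundPropagators]; IR-N06-SECTION-2 road **R1** («J-twin of the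
producer cone», ★★★ director-ym №524 (3): authorised in principle, STAGED, sibling files only), `R1-JTWIN-SPEC.md` rule (R)′ (dag-n06-d, 2026-08-31): re-key EXACTLY
the section-tainted ∀-member rows along `f`, keep data ∕ pins ∕ laws ∕ section-free rows member-wide, tainted conclusions along `f` ((R).3′).
Seat `pub-ymgap-dag-n06-d` g30 — own-producer twins under «KD‴» (`…N06AtOpsYSectEStKnitSectDKDR`).

WHAT.  `vDRDG_vGDRD_of_pinsR_parB_J` = the parent's theorem with `{J : Type} (f : J → MemberY d ℓ hd hL b₀ b₁ Mstar)` added after the `H` binder and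
* TAINTED ROWS OF THIS TWIN: `h49` — print's (3.49) majorant for `P` (⟸ (3.48) rows 15∕16 via `…N06Proj349AtPinsPhysRCPar`) and `h152` — the (3.152) identities
  `Ids3152 …` (in «KD‴» the local `hids`, fed by `FormSmall` of Theorem 3.12 from the Sect.-D layer L2, itself ⟸ row 17 `hΔAK` via `hpos12 ∕ hIdOfForm`), each re-keyed
  `∀ x : MemberY … ↦ ∀ j : J`, read at `f j`;
* LEFT member-wide: Theorem 3.1 `h31`, the (3.46) knit row `h46`, the S-law `hlawS`, the pins `hblk12 hblkW12`, the letter families ∕ pins ∕ laws ∕ instance binders, all x-free numerics ∕ rates ∕ thresholds;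
* conclusion: the x-free constants unchanged, the member clause `∀ j : J, … (f j) …` along `f`.
PROOF: the parent's text by generator (`mkJ.py` over the tree bytes): x-free ∃-witnesses; pointwise body `fun x ↦ fun j`, member reads `x ↦ f j`, `h49 x ↦ h49 j`,
`h152 x ↦ h152 j`; private helpers (if any) restated privately as in the parent; nothing re-derived.
HONEST FRAMING.  Bookkeeping over landed objects; every displayed row is a HYPOTHESIS; nothing of [B9] ∕ [4] asserted; COUNT-NEUTRAL (`--supports stmt-QuantumFields-27239
--as helper`); N06 NOT discharged; K1 NOT closed; under R1 the inner-corner question stays DISPLAYED at the K1 face ∕ NODE O join by (α5); nothing continuum ∕ OS ∕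
mass gap ∕ Clay.  0 `def`, 0 `sorry`.  NEW file; the parent untouched.  The member-wide parent is the instance `J := MemberY …`, `f := id`; ORPHAN by design until
`…N06AtOpsYSectEStKnitSectDKDR`ᴶ («KD‴»ᴶ) lands (honest).
[cite: Balaban1985BackgroundPropagators, Thm 3.1 p.394, (3.46) p.398, (3.49) p.398, (3.151)–(3.153) p.426; Balaban1984PropagatorsII, Lemma 2.1 (2.60)–(2.61) p.234]
-/

noncomputable section

namespace Summit.QuantumFields.YangMills.BalabanUVNodes.N06CutL2LettersAtPinsPhysRParBJ

open Literature.MathematicalPhysics.QuantumFieldTheory.Balaban1983to89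
open Literature.MathematicalPhysics.QuantumFieldTheory.Balaban1983to89.Node00 (FBondY IBondY CfgY GpY GpPhysY parSymY)
open Literature.MathematicalPhysics.QuantumFieldTheory.Balaban1983to89.Node00.OpsYSectDCoords (DvcoKH DvscoKH RcoK isTransposePair_DvcoKH_DvscoKH cR39_trBasis_pos)
open Literature.MathematicalPhysics.QuantumFieldTheory.Balaban1983to89.B9Thm34Ext (toB6)
open Literature.MathematicalPhysics.QuantumFieldTheory.Balaban1983to89.B11SectG (BlockNorm HasMaj RowSum)
open Literature.MathematicalPhysics.QuantumFieldTheory.Balaban1983to89.B9SectDL2Decay (BlockBd)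
open Literature.MathematicalPhysics.QuantumFieldTheory.Balaban1983to89.B9Thm37Glue (IsTransposePair isTransposePair_one)
open Literature.MathematicalPhysics.QuantumFieldTheory.Balaban1983to89.B9Thm37GlueTorusCov (isTransposePair_smul)
open Literature.MathematicalPhysics.QuantumFieldTheory.Balaban1983to89.B9Thm312Whole (GeoOK)
open Literature.MathematicalPhysics.QuantumFieldTheory.Balaban1983to89.B9RWSums343to347Whole (Facts347)
open Literature.MathematicalPhysics.QuantumFieldTheory.Balaban1983to89.B9RWSumsDefinitePins (PinPrims)
open Literature.MathematicalPhysics.QuantumFieldTheory.Balaban1983to89.B9RWSums347DefiniteFaces (exp261 lemma21Pack_geo9Y)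
open Literature.MathematicalPhysics.QuantumFieldTheory.Balaban1983to89.B9PinMembersKLevelV1 (MemberY geo9Y bg9Y)
open Literature.MathematicalPhysics.QuantumFieldTheory.Balaban1983to89.B9BackgroundsKLevelV1R (RegFamY bg9YR MemOfFam mem_of_reg335R)
open Summit.QuantumFields.YangMills.BalabanUVNodes.N06CutL2LettersAtPinsPhys (letters313L2MZ_mono_const)
open Literature.MathematicalPhysics.QuantumFieldTheory.Balaban1983to89.B9GeoLemma21KLevelV1 (geo9Y_len_pos geo9Y_dist_triangle geo9Y_dist_comm rowSum261_geo9Y)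
open Literature.MathematicalPhysics.QuantumFieldTheory.Balaban1983to89.B9GeoNormsKLevelV1 (geo9K_dist_nonneg)
open Literature.MathematicalPhysics.QuantumFieldTheory.Balaban1983to89.B7Prop2SpecialUnitary (specialUnitaryUnits specialUnitaryUnits_le_unitaryUnits)
open Literature.MathematicalPhysics.QuantumFieldTheory.Balaban1983to89.B9CoReadingCoords (XBK blkBK)
open Literature.MathematicalPhysics.QuantumFieldTheory.Balaban1983to89.B9CoReadingCoordsH (XHK)
open Literature.MathematicalPhysics.QuantumFieldTheory.Balaban1983to89.B9CoReadingCoordsS (XSK GcoS blkSK sIK)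
open Literature.MathematicalPhysics.QuantumFieldTheory.Balaban1983to89.B9CoReadingCoordsTranspose (TrIdx trBasis isTransposePair_GcoS_trBasis isTransposePair_coordOpK_of_isSymmTr trBasis_repr_eq_trace)
open Literature.MathematicalPhysics.QuantumFieldTheory.Balaban1983to89.B9Thm39ReadingCoords (cR39 cR39_nonneg)
open Literature.MathematicalPhysics.QuantumFieldTheory.Balaban1983to89.B9PerturbationMajorantAlgebra (Thm31GpMaj Proj349Maj)
open Literature.MathematicalPhysics.QuantumFieldTheory.Balaban1983to89.B9PerturbationMajorantsAtLetters (PcoK rcoK_eq)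
open Literature.MathematicalPhysics.QuantumFieldTheory.Balaban1983to89.B9PerturbationMajorantsAtLettersPhys (rcoK_GpPhysY)
open Literature.MathematicalPhysics.QuantumFieldTheory.Balaban1983to89.B9Thm311AdjointPairs (GpY_isSymmTr)
open Literature.MathematicalPhysics.QuantumFieldTheory.Balaban1983to89.B9Thm313WholeRgdFrom3152 (Ids3152)
open Literature.MathematicalPhysics.QuantumFieldTheory.Balaban1983to89.B9Thm313WholeDirL2Z (Letters313L2MZ)
open Literature.MathematicalPhysics.QuantumFieldTheory.Balaban1983to89.B9Thm313WholeCutLettersL2From3152 (vDRDG_of_ids3152 vGDRD_of_ids3152)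
open Literature.MathematicalPhysics.QuantumFieldTheory.Balaban1983to89.B9Eq346GradGpDivAtPinsL2Closed (B46 δ46 B46_pos)
open Literature.MathematicalPhysics.QuantumFieldTheory.Balaban1983to89.B6GlobalChartV1 (blkV1)
open Literature.MathematicalPhysics.QuantumFieldTheory.Balaban1983to89.B6Ineq2142KLevelV1 (β lvl)
open Literature.MathematicalPhysics.QuantumFieldTheory.Balaban1983to89.B6Geom246MultiLevelTorus (geomT)
open scoped Matrix.Norms.L2Operator
open Literature.MathematicalPhysics.QuantumFieldTheory.Balaban1983to89.B9Thm311ReadingCoords (IsSymmTr)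

variable {N : ℕ} [NeZero N]
variable {d ℓ : ℕ} {hd : 1 ≤ d + 1} {hL : Odd (ℓ + 1) ∧ 1 < ℓ + 1} {b₀ b₁ : ℝ} {Mstar : ℕ}
variable [∀ x : MemberY d ℓ hd hL b₀ b₁ Mstar, Fintype (geo9Y x).Site]


/-- ★★ **THE RE-CUT BLOCK-`L²` LETTERS AT THE PINS OVER A TRANSPORTER PARAMETER `parS`** (module docstring): `vDRDG_vGDRD_of_pinsR` with the symmetrised transporter replaced
by `parS x` in every model and the two transporter facts displayed as `hlawS`.
[cite: Balaban1985BackgroundPropagators, (3.151)–(3.153) p.426, Thm 3.1 (3.42)∕(3.46) pp.397–398, (3.49) p.399, (3.19) p.393, (3.35)–(3.36) p.396; Balaban1984PropagatorsII, (2.51)–(2.56) pp.232–233] -/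
theorem vDRDG_vGDRD_of_pinsR_parB_J {R₁ R₂ : RegFamY d ℓ hd hL b₀ b₁ Mstar (Matrix (Fin N) (Fin N) ℂ)} (hGR : MemOfFam (specialUnitaryUnits (Fin N)) R₁)
    (H : MemberY d ℓ hd hL b₀ b₁ Mstar → Prop) {J : Type} (f : J → MemberY d ℓ hd hL b₀ b₁ Mstar) (parS : ∀ x : MemberY d ℓ hd hL b₀ b₁ Mstar, Node00.SiteParY (Matrix (Fin N) (Fin N) ℂ) x.toKIdx)
    (bI : ∀ x : MemberY d ℓ hd hL b₀ b₁ Mstar, FBondY x.toKIdx → IBondY x.toKIdx)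
    (𝔬12 : ∀ x : MemberY d ℓ hd hL b₀ b₁ Mstar, B9Thm312Whole.Ops (geo9Y x) (bg9YR (Matrix (Fin N) (Fin N) ℂ) (specialUnitaryUnits (Fin N)) R₁ R₂ x)
      (XBK (TrIdx N) x.toKIdx) (XBK (TrIdx N) x.toKIdx) (XHK (TrIdx N) x.toKIdx) (XSK (TrIdx N) x.toKIdx))
    (hblk12 : ∀ x : MemberY d ℓ hd hL b₀ b₁ Mstar, (𝔬12 x).blk = blkBK x.toKIdx (bI x))
    (hblkW12 : ∀ x : MemberY d ℓ hd hL b₀ b₁ Mstar, (𝔬12 x).blkW = blkSK x.toKIdx (sIK x.toKIdx (bI x)))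
    (hDvco12 : ∀ (x : MemberY d ℓ hd hL b₀ b₁ Mstar) (U : (bg9YR (Matrix (Fin N) (Fin N) ℂ) (specialUnitaryUnits (Fin N)) R₁ R₂ x).Cfg),
      (𝔬12 x).Dv U = DvcoKH x.toKIdx (trBasis N) (bg9YR (Matrix (Fin N) (Fin N) ℂ) (specialUnitaryUnits (Fin N)) R₁ R₂ x) (fun U => U) U)
    (hDvsco12 : ∀ (x : MemberY d ℓ hd hL b₀ b₁ Mstar) (U : (bg9YR (Matrix (Fin N) (Fin N) ℂ) (specialUnitaryUnits (Fin N)) R₁ R₂ x).Cfg),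
      (𝔬12 x).Dvstar U = DvscoKH x.toKIdx (trBasis N) (bg9YR (Matrix (Fin N) (Fin N) ℂ) (specialUnitaryUnits (Fin N)) R₁ R₂ x) (fun U => U) U)
    (hRco12 : ∀ (x : MemberY d ℓ hd hL b₀ b₁ Mstar) (U : (bg9YR (Matrix (Fin N) (Fin N) ℂ) (specialUnitaryUnits (Fin N)) R₁ R₂ x).Cfg),
      (𝔬12 x).R U = RcoK x.toKIdx (trBasis N) (bg9YR (Matrix (Fin N) (Fin N) ℂ) (specialUnitaryUnits (Fin N)) R₁ R₂ x) (fun U => U) (parS x) (GpPhysY x.toKIdx (parS x)) U)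
    (q : PinPrims) (hq : q.OK) {c35 : ℝ} {M₁ a₁ B31 δ31 CP δP rT σS δ₃ : ℝ} (B₄₀ : ℝ)
    (hB31 : 0 ≤ B31) (hCP : 0 ≤ CP) (hσS : 0 < σS) (hrTσ : 2 * σS ≤ rT) (hrT31 : rT ≤ δ31) (hrTP : rT ≤ δP)
    -- [CASCADE-K «KD»] the (3.46) line's constant and rate as PARAMETERS (straight: n06-d `B46 ∕ δ46`; knit: dag-n06-l `blockBd_DvGcoSDvs_memberY_knit`'s `B₄ ∕ δ₄`)
    (BD δD : ℝ) (hBD : 0 ≤ BD) (hrT4 : rT ≤ δD) (hδ₃ : δ₃ ≤ (1 - 2 * q.αF) * rT - σS)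
    -- Theorem 3.1 for G′ at the LATTICE letter (the certificate's `h31`, from `thm31GpMaj_of_t37_pairM`)
    (h31 : ∀ x : MemberY d ℓ hd hL b₀ b₁ Mstar, M₁ ≤ (geo9Y x).M → ∀ α₀ : ℝ, 0 < α₀ → (geo9Y x).M * α₀ ≤ a₁ →
      ∀ U : (bg9YR (Matrix (Fin N) (Fin N) ℂ) (specialUnitaryUnits (Fin N)) R₁ R₂ x).Cfg, (bg9YR (Matrix (Fin N) (Fin N) ℂ) (specialUnitaryUnits (Fin N)) R₁ R₂ x).Reg335 c35 α₀ U →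
        Thm31GpMaj (g := geo9Y x) (blkSK x.toKIdx (sIK x.toKIdx (bI x))) (blkBK x.toKIdx (bI x))
          (GcoS x.toKIdx (trBasis N) (bg9YR (Matrix (Fin N) (Fin N) ℂ) (specialUnitaryUnits (Fin N)) R₁ R₂ x) (fun U => U) (GpY x.toKIdx (parS x)) U)
          (DvcoKH x.toKIdx (trBasis N) (bg9YR (Matrix (Fin N) (Fin N) ℂ) (specialUnitaryUnits (Fin N)) R₁ R₂ x) (fun U => U) U)
          (DvscoKH x.toKIdx (trBasis N) (bg9YR (Matrix (Fin N) (Fin N) ℂ) (specialUnitaryUnits (Fin N)) R₁ R₂ x) (fun U => U) U) 1 (H x) B31 δ31)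
    -- (3.49) for P = I − R at the lattice letter (the certificate's `h49`, from `proj349Maj_of_t37_display348_rate`)
    (h49 : ∀ j : J, M₁ ≤ (geo9Y (f j)).M → ∀ α₀ : ℝ, 0 < α₀ → (geo9Y (f j)).M * α₀ ≤ a₁ →
      ∀ U : (bg9YR (Matrix (Fin N) (Fin N) ℂ) (specialUnitaryUnits (Fin N)) R₁ R₂ (f j)).Cfg, (bg9YR (Matrix (Fin N) (Fin N) ℂ) (specialUnitaryUnits (Fin N)) R₁ R₂ (f j)).Reg335 c35 α₀ U →
        Proj349Maj (g := geo9Y (f j)) (blkSK (f j).toKIdx (sIK (f j).toKIdx (bI (f j)))) (blkBK (f j).toKIdx (bI (f j)))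
          (PcoK (f j).toKIdx (trBasis N) (bg9YR (Matrix (Fin N) (Fin N) ℂ) (specialUnitaryUnits (Fin N)) R₁ R₂ (f j)) (fun U => U) (parS (f j)) (GpY (f j).toKIdx (parS (f j))) U)
          (DvcoKH (f j).toKIdx (trBasis N) (bg9YR (Matrix (Fin N) (Fin N) ℂ) (specialUnitaryUnits (Fin N)) R₁ R₂ (f j)) (fun U => U) U)
          (DvscoKH (f j).toKIdx (trBasis N) (bg9YR (Matrix (Fin N) (Fin N) ℂ) (specialUnitaryUnits (Fin N)) R₁ R₂ (f j)) (fun U => U) U) 1 (H (f j)) CP δP)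
    -- (3.46)₄ for DG′D\* at the lattice letter, CLOSED constants (the certificate's `h46`, dag-n06-w7 `blockBd_DvGcoSDvs_memberY_at`)
    (h46 : ∀ x : MemberY d ℓ hd hL b₀ b₁ Mstar, M₁ ≤ (geo9Y x).M → ∀ α₀ : ℝ, 0 < α₀ → (geo9Y x).M * α₀ ≤ a₁ →
      ∀ U : (bg9YR (Matrix (Fin N) (Fin N) ℂ) (specialUnitaryUnits (Fin N)) R₁ R₂ x).Cfg, (bg9YR (Matrix (Fin N) (Fin N) ℂ) (specialUnitaryUnits (Fin N)) R₁ R₂ x).Reg335 c35 α₀ U →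
        BlockBd (g := toB6 (geo9Y x) 1 (H x)) (𝔬12 x).blk (𝔬12 x).blk
          (DvcoKH x.toKIdx (trBasis N) (bg9YR (Matrix (Fin N) (Fin N) ℂ) (specialUnitaryUnits (Fin N)) R₁ R₂ x) (fun U => U) U ∘ₗ
            GcoS x.toKIdx (trBasis N) (bg9YR (Matrix (Fin N) (Fin N) ℂ) (specialUnitaryUnits (Fin N)) R₁ R₂ x) (fun U => U) (GpY x.toKIdx (parS x)) U ∘ₗ
              DvscoKH x.toKIdx (trBasis N) (bg9YR (Matrix (Fin N) (Fin N) ℂ) (specialUnitaryUnits (Fin N)) R₁ R₂ x) (fun U => U) U)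
          (fun (y y' : (geo9Y x).Site) => BD * Real.exp (-(δD * (geo9Y x).dist y y'))))
    -- [CASCADE-K K2] the two transporter LAWS at the member, displayed (today: `symm0` and `R`-symmetry at the symmetrised transporter; knit: dag-n06-l's at print's transporter on (3.35))
    (hlawS : ∀ x : MemberY d ℓ hd hL b₀ b₁ Mstar, M₁ ≤ (geo9Y x).M → ∀ α₀ : ℝ, 0 < α₀ → (geo9Y x).M * α₀ ≤ a₁ →
      ∀ U : (bg9YR (Matrix (Fin N) (Fin N) ℂ) (specialUnitaryUnits (Fin N)) R₁ R₂ x).Cfg, (bg9YR (Matrix (Fin N) (Fin N) ℂ) (specialUnitaryUnits (Fin N)) R₁ R₂ x).Reg335 c35 α₀ U →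
        IsSymmTr (fun _ => (1 : ℝ)) (Node00.deltaPrimeAY x.toKIdx (parS x) U) ∧ IsSymmTr (fun _ => (1 : ℝ)) (Node00.RY x.toKIdx (parS x) (GpY x.toKIdx (parS x)) U))
    -- the DISPLAYED identity (3.152) at the G′ model `GcoS … (GpY …)` (which CARRIES print's η²: `GcoS … O U = (etaS²·cR39 b) • coordOpK …` — node00-def-Y LOCATED-152)
    (h152 : ∀ j : J, M₁ ≤ (geo9Y (f j)).M → ∀ α₀ : ℝ, 0 < α₀ → (geo9Y (f j)).M * α₀ ≤ a₁ →
      ∀ U : (bg9YR (Matrix (Fin N) (Fin N) ℂ) (specialUnitaryUnits (Fin N)) R₁ R₂ (f j)).Cfg, (bg9YR (Matrix (Fin N) (Fin N) ℂ) (specialUnitaryUnits (Fin N)) R₁ R₂ (f j)).Reg335 c35 α₀ U →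
        (bg9YR (Matrix (Fin N) (Fin N) ℂ) (specialUnitaryUnits (Fin N)) R₁ R₂ (f j)).Reg336 c35 α₀ U →
          Ids3152 (𝔬12 (f j)) (fun U => GcoS (f j).toKIdx (trBasis N) (bg9YR (Matrix (Fin N) (Fin N) ℂ) (specialUnitaryUnits (Fin N)) R₁ R₂ (f j)) (fun U => U) (GpY (f j).toKIdx (parS (f j))) U) U) :
    ∃ (Mc B₄ : ℝ), M₁ ≤ Mc ∧ B₄₀ ≤ B₄ ∧
      ∀ j : J, Mc ≤ (geo9Y (f j)).M → ∀ α₀ : ℝ, 0 < α₀ → (geo9Y (f j)).M * α₀ ≤ a₁ →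
        ∀ U : (bg9YR (Matrix (Fin N) (Fin N) ℂ) (specialUnitaryUnits (Fin N)) R₁ R₂ (f j)).Cfg, (bg9YR (Matrix (Fin N) (Fin N) ℂ) (specialUnitaryUnits (Fin N)) R₁ R₂ (f j)).Reg335 c35 α₀ U →
          (bg9YR (Matrix (Fin N) (Fin N) ℂ) (specialUnitaryUnits (Fin N)) R₁ R₂ (f j)).Reg336 c35 α₀ U →
            BlockBd (g := toB6 (geo9Y (f j)) 1 (H (f j))) (𝔬12 (f j)).blk (𝔬12 (f j)).blk ((𝔬12 (f j)).Dv U ∘ₗ (𝔬12 (f j)).R U ∘ₗ (𝔬12 (f j)).Dvstar U ∘ₗ (𝔬12 (f j)).G1 U)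
                (fun (y y' : (geo9Y (f j)).Site) => B₄ * (((geo9Y (f j)).len y)⁻¹ * (geo9Y (f j)).len y') * Real.exp (-(δ₃ * (geo9Y (f j)).dist y y'))) ∧
              BlockBd (g := toB6 (geo9Y (f j)) 1 (H (f j))) (𝔬12 (f j)).blk (𝔬12 (f j)).blk ((𝔬12 (f j)).G1 U ∘ₗ (𝔬12 (f j)).Dv U ∘ₗ (𝔬12 (f j)).R U ∘ₗ (𝔬12 (f j)).Dvstar U)
                (fun (y y' : (geo9Y (f j)).Site) => B₄ * ((geo9Y (f j)).len y * ((geo9Y (f j)).len y')⁻¹) * Real.exp (-(δ₃ * (geo9Y (f j)).dist y y'))) := by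
  have hN0 : 0 < N := Nat.pos_of_ne_zero (NeZero.ne N)
  have hc0 : 0 < cR39 (trBasis N) := cR39_trBasis_pos hN0
  have hϱ : 0 ≤ (cR39 (trBasis N))⁻¹ := inv_nonneg.mpr hc0.le
  have hrT0 : 0 < rT := by linarith only [hσS, hrTσ]
  have h2α : 0 < 1 - 2 * q.α := by linarith only [hq.α_lt]
  -- the member facts at the rate rT (exponent α := q.α inside `exp261`, transfer exponent α_F) and [4] (2.61) at the rate σS, above ONE threshold each
  obtain ⟨Mth, -, hfacts, -⟩ := lemma21Pack_geo9Y (d := d) (ℓ := ℓ) (hd := hd) (hL := hL) (b₀ := b₀) (b₁ := b₁) (Mstar := Mstar) H hq.α_pos hq.α_lt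
    (div_pos hrT0 h2α) hq.αF_pos (by linarith only [hq.αF_lt])
  have hrate : (1 - 2 * q.α) * (rT / (1 - 2 * q.α)) = rT := mul_div_cancel₀ rT h2α.ne'
  obtain ⟨ML, c₁, hrow⟩ := rowSum261_geo9Y (d := d) (ℓ := ℓ) (hd := hd) (hL := hL) (b₀ := b₀) (b₁ := b₁) (Mstar := Mstar) σS hσS
  set c : ℝ := max c₁ 0 with hcdef
  have hc : 0 ≤ c := le_max_right _ _
  set L₀ : ℝ := ((ℓ + 1 : ℕ) : ℝ) with hL₀
  set B₄ : ℝ := max B₄₀ ((cR39 (trBasis N))⁻¹ * L₀ * (BD + CP * L₀ * B31 * c)) with hB₄def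
  have hL₀0 : 0 ≤ L₀ := by rw [hL₀]; positivity
  have hB₄b : (cR39 (trBasis N))⁻¹ * L₀ * (BD + CP * L₀ * B31 * c) ≤ B₄ := le_max_right _ _
  -- the rate bookkeeping of `vDRDG_of_ids3152` at (δ := rT, α := q.αF, σ := σS)
  have hαδ : 0 ≤ q.αF * rT := mul_nonneg hq.αF_pos.le hrT0.le
  have hαF2 : q.αF * rT ≤ rT / 2 := by have := hq.αF_lt; nlinarith [hrT0.le, this]
  have hbud : 0 ≤ rT - σS - q.αF * rT := by linarith only [hrTσ, hαF2, hrT0.le]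
  have hδD : rT - σS - q.αF * rT ≤ δD := by linarith only [hrT4, hσS.le, hαδ]
  have hδ₄ : δ₃ ≤ rT - σS - 2 * (q.αF * rT) := by linarith only [hδ₃]
  refine ⟨max M₁ (max Mth ML), B₄, le_max_left _ _, le_max_left _ _, fun j hM α₀ hα ha U hU hU' => ?_⟩
  have hM1x : M₁ ≤ (geo9Y (f j)).M := (le_max_left _ _).trans hM
  have hMthx : Mth ≤ (geo9Y (f j)).M := ((le_max_left _ _).trans (le_max_right _ _)).trans hM
  have hMLx : ML ≤ (geo9Y (f j)).M := ((le_max_right _ _).trans (le_max_right _ _)).trans hM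
  have hG : GeoOK (geo9Y (f j)) := ⟨geo9Y_dist_triangle (f j), geo9Y_dist_comm (f j), geo9K_dist_nonneg (f j).toKIdx, geo9Y_len_pos (f j)⟩
  have hF := hfacts (f j) hMthx
  rw [hrate] at hF
  have hrowx : RowSum (toB6 (geo9Y (f j)) 1 (H (f j))) σS c := fun y => (hrow (f j) hMLx y).trans (le_max_left _ _)
  have hUu : ∀ μ z, ((U μ z : (Matrix (Fin N) (Fin N) ℂ)ˣ) : Matrix (Fin N) (Fin N) ℂ) ∈ unitary (Matrix (Fin N) (Fin N) ℂ) :=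
    fun μ z => specialUnitaryUnits_le_unitaryUnits ((mem_of_reg335R hGR (f j) hU) μ z)
  -- Theorem 3.1 read for (𝔬12 (f j))'s block maps and divergence letters (NO units transfer: `GcoS` carries η², def-Y LOCATED-152)
  have h31p : Thm31GpMaj (g := geo9Y (f j)) (𝔬12 (f j)).blkW (𝔬12 (f j)).blk (GcoS (f j).toKIdx (trBasis N) (bg9YR (Matrix (Fin N) (Fin N) ℂ) (specialUnitaryUnits (Fin N)) R₁ R₂ (f j)) (fun U => U) (GpY (f j).toKIdx (parS (f j))) U) ((𝔬12 (f j)).Dv U) ((𝔬12 (f j)).Dvstar U) 1 (H (f j)) B31 δ31 := by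
    rw [hblkW12 (f j), hblk12 (f j), hDvco12 (f j) U, hDvsco12 (f j) U]; exact h31 (f j) hM1x α₀ hα ha U hU
  -- (3.49) read for (𝔬12 (f j))'s letters
  have h49p : Proj349Maj (g := geo9Y (f j)) (𝔬12 (f j)).blkW (𝔬12 (f j)).blk
      (PcoK (f j).toKIdx (trBasis N) (bg9YR (Matrix (Fin N) (Fin N) ℂ) (specialUnitaryUnits (Fin N)) R₁ R₂ (f j)) (fun U => U) (parS (f j)) (GpY (f j).toKIdx (parS (f j))) U)
      ((𝔬12 (f j)).Dv U) ((𝔬12 (f j)).Dvstar U) 1 (H (f j)) CP δP := by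
    rw [hblkW12 (f j), hblk12 (f j), hDvco12 (f j) U, hDvsco12 (f j) U]; exact h49 j hM1x α₀ hα ha U hU
  -- (3.46)₄ read for (𝔬12 (f j))'s divergence letters
  have h46p : BlockBd (g := toB6 (geo9Y (f j)) 1 (H (f j))) (𝔬12 (f j)).blk (𝔬12 (f j)).blk ((𝔬12 (f j)).Dv U ∘ₗ GcoS (f j).toKIdx (trBasis N) (bg9YR (Matrix (Fin N) (Fin N) ℂ) (specialUnitaryUnits (Fin N)) R₁ R₂ (f j)) (fun U => U) (GpY (f j).toKIdx (parS (f j))) U ∘ₗ (𝔬12 (f j)).Dvstar U)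
      (fun (y y' : (geo9Y (f j)).Site) => BD * Real.exp (-(δD * (geo9Y (f j)).dist y y'))) := by
    rw [hDvco12 (f j) U, hDvsco12 (f j) U]; exact h46 (f j) hM1x α₀ hα ha U hU
  -- R = ϱ(I − P) at the models (R is degree-0 homogeneous in G′: `rcoK_GpPhysY`)
  have hR : (𝔬12 (f j)).R U = (cR39 (trBasis N))⁻¹ • (LinearMap.id -
      PcoK (f j).toKIdx (trBasis N) (bg9YR (Matrix (Fin N) (Fin N) ℂ) (specialUnitaryUnits (Fin N)) R₁ R₂ (f j)) (fun U => U) (parS (f j)) (GpY (f j).toKIdx (parS (f j))) U) := by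
    rw [hRco12 (f j) U, rcoK_GpPhysY, rcoK_eq]
  -- the transposition letters
  have hGsym := isTransposePair_GcoS_trBasis (f j).toKIdx (bg9YR (Matrix (Fin N) (Fin N) ℂ) (specialUnitaryUnits (Fin N)) R₁ R₂ (f j)) (fun U => U)
    (GpY (f j).toKIdx (parS (f j))) U (GpY_isSymmTr (f j).toKIdx (parS (f j)) U (hlawS (f j) hM1x α₀ hα ha U hU).1)
  have hGpT : IsTransposePair (GcoS (f j).toKIdx (trBasis N) (bg9YR (Matrix (Fin N) (Fin N) ℂ) (specialUnitaryUnits (Fin N)) R₁ R₂ (f j)) (fun U => U) (GpY (f j).toKIdx (parS (f j))) U) (GcoS (f j).toKIdx (trBasis N) (bg9YR (Matrix (Fin N) (Fin N) ℂ) (specialUnitaryUnits (Fin N)) R₁ R₂ (f j)) (fun U => U) (GpY (f j).toKIdx (parS (f j))) U) := hGsym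
  have hDvT : IsTransposePair ((𝔬12 (f j)).Dv U) ((𝔬12 (f j)).Dvstar U) := by
    rw [hDvco12 (f j) U, hDvsco12 (f j) U]
    exact isTransposePair_DvcoKH_DvscoKH (f j).toKIdx (bg9YR (Matrix (Fin N) (Fin N) ℂ) (specialUnitaryUnits (Fin N)) R₁ R₂ (f j)) (fun U => U) U hUu
  have hRsym : IsTransposePair (RcoK (f j).toKIdx (trBasis N) (bg9YR (Matrix (Fin N) (Fin N) ℂ) (specialUnitaryUnits (Fin N)) R₁ R₂ (f j)) (fun U => U) (parS (f j)) (GpY (f j).toKIdx (parS (f j))) U)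
      (RcoK (f j).toKIdx (trBasis N) (bg9YR (Matrix (Fin N) (Fin N) ℂ) (specialUnitaryUnits (Fin N)) R₁ R₂ (f j)) (fun U => U) (parS (f j)) (GpY (f j).toKIdx (parS (f j))) U) :=
    isTransposePair_smul (isTransposePair_coordOpK_of_isSymmTr (trBasis N) (trBasis_repr_eq_trace N) _ (hlawS (f j) hM1x α₀ hα ha U hU).2) _
  have hPeq : PcoK (f j).toKIdx (trBasis N) (bg9YR (Matrix (Fin N) (Fin N) ℂ) (specialUnitaryUnits (Fin N)) R₁ R₂ (f j)) (fun U => U) (parS (f j))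
      (GpY (f j).toKIdx (parS (f j))) U = 1 - (cR39 (trBasis N)) •
        RcoK (f j).toKIdx (trBasis N) (bg9YR (Matrix (Fin N) (Fin N) ℂ) (specialUnitaryUnits (Fin N)) R₁ R₂ (f j)) (fun U => U) (parS (f j)) (GpY (f j).toKIdx (parS (f j))) U := by
    rw [rcoK_eq, smul_smul, mul_inv_cancel₀ hc0.ne', one_smul, Module.End.one_eq_id, sub_sub_cancel]
  have hPT : IsTransposePair
      (PcoK (f j).toKIdx (trBasis N) (bg9YR (Matrix (Fin N) (Fin N) ℂ) (specialUnitaryUnits (Fin N)) R₁ R₂ (f j)) (fun U => U) (parS (f j)) (GpY (f j).toKIdx (parS (f j))) U)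
      (PcoK (f j).toKIdx (trBasis N) (bg9YR (Matrix (Fin N) (Fin N) ℂ) (specialUnitaryUnits (Fin N)) R₁ R₂ (f j)) (fun U => U) (parS (f j)) (GpY (f j).toKIdx (parS (f j))) U) := by
    rw [hPeq]; exact isTransposePair_one.sub (isTransposePair_smul hRsym _)
  have hI := h152 j hM1x α₀ hα ha U hU hU'
  exact ⟨vDRDG_of_ids3152 (P := fun U => PcoK (f j).toKIdx (trBasis N) (bg9YR (Matrix (Fin N) (Fin N) ℂ) (specialUnitaryUnits (Fin N)) R₁ R₂ (f j)) (fun U => U) (parS (f j))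
        (GpY (f j).toKIdx (parS (f j))) U) hG hF hrowx h31p h49p h46p hR hI hGpT hDvT hPT hϱ hB31 hCP hBD hc hσS.le hαδ hrT31 hrTP hbud hδD
        hB₄b hδ₄,
      vGDRD_of_ids3152 (P := fun U => PcoK (f j).toKIdx (trBasis N) (bg9YR (Matrix (Fin N) (Fin N) ℂ) (specialUnitaryUnits (Fin N)) R₁ R₂ (f j)) (fun U => U) (parS (f j))
        (GpY (f j).toKIdx (parS (f j))) U) hG hF hrowx h31p h49p h46p hR hI hGpT hDvT hPT hϱ hB31 hCP hBD hc hσS.le hαδ hrT31 hrTP hbud hδD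
        hB₄b hδ₄⟩

end Summit.QuantumFields.YangMills.BalabanUVNodes.N06CutL2LettersAtPinsPhysRParBJ
end
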